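import Summits.BirchSwinnertonDyer.BirchSwinnertonDyer.Theorems.CMKolyvaginAtInertTwoPairOfRatCarrierAtTwo
import Summits.BirchSwinnertonDyer.BirchSwinnertonDyer.Theorems.CMKolyvaginAtInertTwoPairCurrencyAtTwoPure
import Summits.BirchSwinnertonDyer.BirchSwinnertonDyer.Theorems.GenusKolyvaginAtTwoVisiblePairAtTwoDefs
import Summits.BirchSwinnertonDyer.BirchSwinnertonDyer.Theorems.GenusKolyvaginAtTwoEquivariantKolyvaginExactAtTwoKolyvaginPrimeDictionary
import Summits.BirchSwinnertonDyer.BirchSwinnertonDyer.Theorems.GenusKolyvaginAtTwoEquivariantKolyvaginExactAtTwoTwistLocalConditions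
import Summits.BirchSwinnertonDyer.BirchSwinnertonDyer.Theorems.GenusKolyvaginAtTwoEquivariantKolyvaginExactAtTwoTwinGrossPrimes
import Summits.BirchSwinnertonDyer.BirchSwinnertonDyer.Theorems.KolyvaginRoadThreeMethod2LocalInputsLineTrans
import Literature.NumberTheory.EllipticCurves.SelmerCorankControlRatProofs
import Literature.NumberTheory.EllipticCurves.LFunctionPrimeCoeff
import Literature.NumberTheory.EllipticCurves.HeegnerPointsKolyvaginSplitDescentPairData
import HarnessLib

/-!
# Route `CMKolyvaginAtInertTwo`, crux `CMKolyvaginExactAtInertTwo` (stmt-BirchSwinnertonDyer-24277):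
# path (β) of the T2 assembly — the LOCAL COMPATIBILITY `hA` at Kolyvagin primes: the strict conditions
# `a₁ × a₂` of the `ℚ`-pair are the preimage of the eigen-pair's `pairA` under `f = (res, ψ ∘ res)`

Seat `bsd-line-cmk2-p1` g17 (cell `bsd-print-cf2`); helper (`--supports stmt-BirchSwinnertonDyer-24277`).
THEOREMS ONLY: no definition, no named fact, no `sorry`; no item is closed; BSD is not proved by this.

KERNEL-STATUS-p2-port.md §17.4, input `hA` of `card_mul_card_le_two_pow_two_mul_of_pairData`. At a
Gross-form Kolyvagin prime `ℓ` (odd, `ℓ ∤ d_K`, inert in `K`: `λ = IsKolyvaginPrime.place`, residue degree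
`2`) of good reduction with `Frob_ℓ ∼ τ` on `E[2^M]`:
`x ∈ torsionLocalKer_ℓ(E/ℚ) ⟺ res x ∈ torsionLocalKer_λ(E/K)` — the `GenusKolyvaginAtTwo` LINE 6 dictionary
`GenusExact.SelmerDescent.zsmul_mem_torsionLocalKer_iff_resTorsion_of_notMem` (gk2-p3), no image hypothesis — and the same
for the twin `E^{(d_K)}` (its `Δ < 0`, good reduction at `ℓ` and `Frob_ℓ ∼ τ` are inherited:
`TwinGrossPrimes.Δ_neg/hasGoodReductionAtPrime/frobEqFrobInfty_of_smul_quadraticTwist_eq`) followed by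
`ψ = hPsiKT` (`mem_torsionLocalKer_iff_hPsiKT_mem`). Hence for two-member data `D` with `D.A₁ = a₁ W M`,
`D.A₂ = a₂ W K M`: `v ∈ D.toSplitData.A ℓ ⟺ f v ∈ pairA ℓ`.

* `mem_torsionLocalKer_iff_resTorsion_mem_place` (member `E`), `mem_torsionLocalKer_twin_iff_hPsiKT_mem_place`
  (member `E^{(d_K)}`), `mem_toSplitData_A_iff_mem_pairA` (**`hA`**).

References: [McCallumLMS1991] §3 (3), §4 Prop. 4.4, §5 Lemma 5.3; [GrossLMS1991] §3 (3.2), Prop. 9.6;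
[Kolyvagin1989Izv] §3.
-/

-- single-conjunct summit: `Summit.BirchSwinnertonDyer.BirchSwinnertonDyer.…` repeats the name by design
set_option linter.dupNamespace false
set_option autoImplicit false

noncomputable section

open scoped Classical
open WeierstrassCurve NumberField IsDedekindDomain Field Rat.HeightOneSpectrum
open Literature.NumberTheory.GaloisRepresentations
open Literature.NumberTheory.EllipticCurves Literature.NumberTheory.EllipticCurves.KolyvaginDescent
open Summit.BirchSwinnertonDyer.BirchSwinnertonDyer.Theorems.GenusExact.EigenClassesFinite
open Summit.BirchSwinnertonDyer.BirchSwinnertonDyer.Theorems.GenusExact.VisiblePairAtTwo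
open Summit.BirchSwinnertonDyer.BirchSwinnertonDyer.Theorems.GenusExact.TwinGrossPrimes
open Summit.BirchSwinnertonDyer.Rank1Residual.X11b.Three.Koly.Method2 (LocalFrob.inertiaDeg_eq_two_of_isPrime_span)

namespace Summit.BirchSwinnertonDyer.BirchSwinnertonDyer.Theorems.KolyvaginPairDataTwo

variable {N : ℕ} (W : WeierstrassCurve ℚ) {K : Type} [Field K] [NumberField K]

/-! ## The place `λ` of a Kolyvagin prime lies over `v_ℓ` with residue degree `2` -/

/-- For a Gross-form Kolyvagin prime `ℓ`: `(ℓ) ∈ v_ℓ`, `λ = IsKolyvaginPrime.place` lies over `v_ℓ`, and its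
residue degree is `2` (`K` quadratic, `(ℓ)` prime in `𝓞_K`). [cite: GrossLMS1991, §3 (3.1)–(3.2)] -/
theorem place_liesOver_and_inertiaDeg {ℓ : ℕ} (h2 : Module.finrank ℚ K = 2)
    (hℓ : IsKolyvaginPrime N W K 2 ℓ) :
    (ℓ : 𝓞 ℚ) ∈ (primesEquiv.symm ⟨ℓ, hℓ.prime⟩ : HeightOneSpectrum (𝓞 ℚ)).asIdeal ∧
      hℓ.place.asIdeal.LiesOver (primesEquiv.symm ⟨ℓ, hℓ.prime⟩ : HeightOneSpectrum (𝓞 ℚ)).asIdeal ∧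
      hℓ.place.asIdeal.inertiaDeg (𝓞 ℚ) = 2 := by
  have hℓp : ℓ.Prime := hℓ.prime
  set vℓ : HeightOneSpectrum (𝓞 ℚ) := hℓ.place.under (𝓞 ℚ) with hvℓ
  have hℓvℓ : (ℓ : 𝓞 ℚ) ∈ vℓ.asIdeal := by
    change (ℓ : 𝓞 ℚ) ∈ (hℓ.place.asIdeal.comap (algebraMap (𝓞 ℚ) (𝓞 K)))
    rw [Ideal.mem_comap, map_natCast]
    exact hℓ.mem_place
  have hvℓeq : vℓ = primesEquiv.symm ⟨ℓ, hℓp⟩ := (natCast_prime_mem_iff_eq hℓp vℓ).mp hℓvℓ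
  have hLO : hℓ.place.asIdeal.LiesOver vℓ.asIdeal := ⟨rfl⟩
  rw [hvℓeq] at hℓvℓ hLO
  exact ⟨hℓvℓ, hLO, LocalFrob.inertiaDeg_eq_two_of_isPrime_span K h2 hℓp hℓ.2.2.2.2.1 hℓ.place hℓ.mem_place⟩

/-! ## Member `E`: the dictionary at `λ` -/

/-- **Member `E` at a Kolyvagin prime**: `x ∈ torsionLocalKer_ℓ(E/ℚ) ⟺ res x ∈ torsionLocalKer_λ(E/K)`
(`Δ < 0`, good reduction at `ℓ`, `Frob_ℓ ∼ τ` on `E[2^M]`, `1 ≤ M`; no image hypothesis).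
[cite: McCallumLMS1991, §4 Prop. 4.4] [cite: GrossLMS1991, Prop. 9.6] -/
theorem mem_torsionLocalKer_iff_resTorsion_mem_place [NeZero N] [W.IsElliptic] (hΔ : W.Δ < 0)
    (h2 : Module.finrank ℚ K = 2) {θ : K} (hθ : θ ∉ Set.range (algebraMap ℚ K))
    (hd : θ ^ 2 = algebraMap ℚ K ((NumberField.discr K : ℤ) : ℚ)) {M : ℕ} (hM : 1 ≤ M)
    {ℓ : ℕ} (hℓ : IsKolyvaginPrime N W K 2 ℓ) (hgood : (haveI : Fact ℓ.Prime := ⟨hℓ.prime⟩;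
      W.HasGoodReductionAtPrime ℓ)) (hℓM : FrobEqFrobInfty W K (2 ^ M) ℓ)
    (x : galH1Torsion W (lvl M)) :
    x ∈ W.torsionLocalKer ((primesEquiv.symm ⟨ℓ, hℓ.prime⟩ : HeightOneSpectrum (𝓞 ℚ)).adicCompletion ℚ)
        (lvl M) ↔
      resTorsion W K (lvl M) x ∈ (W.baseChange K).torsionLocalKer (hℓ.place.adicCompletion K) (lvl M) := by
  have hℓp : ℓ.Prime := hℓ.prime
  obtain ⟨hℓv, hLO, hf2⟩ := place_liesOver_and_inertiaDeg W h2 hℓ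
  haveI := hLO
  haveI : Fact ℓ.Prime := ⟨hℓp⟩
  have hgoodv : W.HasGoodReductionAt (primesEquiv.symm ⟨ℓ, hℓp⟩ : HeightOneSpectrum (𝓞 ℚ)) :=
    (hasGoodReductionAtPrime_primesEquiv_iff_holds W _ ℓ (primesEquiv_eq_of_natCast_mem hℓp hℓv)).mp hgood
  have hcv : ((NumberField.discr K : ℤ) : 𝓞 ℚ) ∉
      (primesEquiv.symm ⟨ℓ, hℓp⟩ : HeightOneSpectrum (𝓞 ℚ)).asIdeal :=
    intCast_notMem_of_not_dvd hℓp hℓv hℓ.2.2.1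
  have h := GenusExact.SelmerDescent.zsmul_mem_torsionLocalKer_iff_resTorsion_of_notMem W hΔ hM rfl hℓp hℓ.2.2.2.1 hℓv
    hgoodv h2 (not_mem_range hθ) hd hcv hℓM hℓ.place hf2 x 1
  rwa [one_zsmul, one_zsmul] at h

/-! ## Member `E^{(d_K)}`: the dictionary for the twin, then `ψ` -/

/-- **Member `E^{(d_K)}` at a Kolyvagin prime**: `y ∈ torsionLocalKer_ℓ(E^{(d_K)}/ℚ) ⟺ ψ(res y) ∈ torsionLocalKer_λ(E/K)`
(the twin inherits `Δ < 0`, good reduction at `ℓ ∤ d_K` and `Frob_ℓ ∼ τ`; then `hPsiKT` respects the strict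
kernels). [cite: McCallumLMS1991, §4 Prop. 4.4] [cite: Kolyvagin1989Izv, §3] [cite: SilvermanAEC2009, X.5 Cor. 5.4] -/
theorem mem_torsionLocalKer_twin_iff_hPsiKT_mem_place [NeZero N] [W.IsElliptic] [(twin W K).IsElliptic]
    (hK : IsImaginaryQuadratic K) (hodd : Odd (NumberField.discr K)) (hΔ : W.Δ < 0)
    (h2 : Module.finrank ℚ K = 2) {θ : K} (hθ : θ ∉ Set.range (algebraMap ℚ K))
    (hd : θ ^ 2 = algebraMap ℚ K ((NumberField.discr K : ℤ) : ℚ)) {M : ℕ} (hM : 1 ≤ M)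
    {ℓ : ℕ} (hℓ : IsKolyvaginPrime N W K 2 ℓ) (hgood : (haveI : Fact ℓ.Prime := ⟨hℓ.prime⟩;
      W.HasGoodReductionAtPrime ℓ)) (hℓM : FrobEqFrobInfty W K (2 ^ M) ℓ)
    (y : galH1Torsion (twin W K) (lvl M)) :
    y ∈ (twin W K).torsionLocalKer
        ((primesEquiv.symm ⟨ℓ, hℓ.prime⟩ : HeightOneSpectrum (𝓞 ℚ)).adicCompletion ℚ) (lvl M) ↔
      hPsiKT W K hθ hd (lvl M) (resTorsion (twin W K) K (lvl M) y) ∈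
        (W.baseChange K).torsionLocalKer (hℓ.place.adicCompletion K) (lvl M) := by
  have hℓp : ℓ.Prime := hℓ.prime
  haveI : Fact ℓ.Prime := ⟨hℓp⟩
  obtain ⟨hℓv, hLO, hf2⟩ := place_liesOver_and_inertiaDeg W h2 hℓ
  haveI := hLO
  have hdQ : ((NumberField.discr K : ℤ) : ℚ) ≠ 0 := by exact_mod_cast NumberField.discr_ne_zero K
  have hC1 : (1 : VariableChange ℚ) • W.quadraticTwist ((NumberField.discr K : ℤ) : ℚ) = twin W K :=
    one_smul _ _
  have hΔ' : (twin W K).Δ < 0 := Δ_neg_of_smul_quadraticTwist_eq W hdQ (twin W K) hC1 hΔ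
  have hgood' : (twin W K).HasGoodReductionAtPrime ℓ :=
    hasGoodReductionAtPrime_of_smul_quadraticTwist_eq W h2 hodd (twin W K) hC1 hℓ.2.2.1 hgood
  have hgoodv : (twin W K).HasGoodReductionAt (primesEquiv.symm ⟨ℓ, hℓp⟩ : HeightOneSpectrum (𝓞 ℚ)) :=
    (hasGoodReductionAtPrime_primesEquiv_iff_holds (twin W K) _ ℓ (primesEquiv_eq_of_natCast_mem hℓp hℓv)).mp
      hgood'
  have hℓM' : FrobEqFrobInfty (twin W K) K (2 ^ M) ℓ :=
    frobEqFrobInfty_of_smul_quadraticTwist_eq W hK (twin W K) hC1 hℓM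
  have hcv : ((NumberField.discr K : ℤ) : 𝓞 ℚ) ∉
      (primesEquiv.symm ⟨ℓ, hℓp⟩ : HeightOneSpectrum (𝓞 ℚ)).asIdeal :=
    intCast_notMem_of_not_dvd hℓp hℓv hℓ.2.2.1
  have h := GenusExact.SelmerDescent.zsmul_mem_torsionLocalKer_iff_resTorsion_of_notMem (twin W K) hΔ' hM rfl hℓp
    hℓ.2.2.2.1 hℓv hgoodv h2 (not_mem_range hθ) hd hcv hℓM' hℓ.place hf2 y 1
  rw [one_zsmul, one_zsmul] at h
  rw [h]
  exact mem_torsionLocalKer_iff_hPsiKT_mem W K hθ hd (lvl M) (hℓ.place.adicCompletion K)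
    (resTorsion (twin W K) K (lvl M) y)

/-! ## `hA` -/

/-- **`hA` for the `ℚ`-pair carrier**: for two-member data `D` with `D.A₁ = a₁ W M`, `D.A₂ = a₂ W K M` and
`f` with `(f v).1 = res v.1`, `(f v).2 = ψ (res v.2)`, at every Gross-form Kolyvagin prime `ℓ` of good
reduction with `Frob_ℓ ∼ τ` on `E[2^M]`: `v ∈ D.toSplitData.A ℓ ⟺ f v ∈ pairA ℓ`.
[cite: McCallumLMS1991, §3 (3), §4 Prop. 4.4] [cite: Kolyvagin1989Izv, §3] -/
theorem mem_toSplitData_A_iff_mem_pairA [NeZero N] [W.IsElliptic] [(twin W K).IsElliptic]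
    (hK : IsImaginaryQuadratic K) (hodd : Odd (NumberField.discr K)) (hΔ : W.Δ < 0)
    (h2 : Module.finrank ℚ K = 2) {θ : K} (hθ : θ ∉ Set.range (algebraMap ℚ K))
    (hd : θ ^ 2 = algebraMap ℚ K ((NumberField.discr K : ℤ) : ℚ)) {M : ℕ} (hM : 1 ≤ M)
    {Pl : Type*} (D : PairDataM (galH1Torsion W (lvl M)) (galH1Torsion (twin W K) (lvl M)) Pl)
    (hDA₁ : D.A₁ = a₁ W M) (hDA₂ : D.A₂ = a₂ W K M)
    (f : galH1Torsion W (lvl M) × galH1Torsion (twin W K) (lvl M) →+ PairV W (sigmaQ K h2 hθ hd) M 1)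
    (hf₁ : ∀ v, ((f v).1 : galH1Torsion (W.baseChange K) ((2 ^ M : ℕ) : ℤ)) = resTorsion W K (lvl M) v.1)
    (hf₂ : ∀ v, ((f v).2 : galH1Torsion (W.baseChange K) ((2 ^ M : ℕ) : ℤ)) =
      hPsiKT W K hθ hd (lvl M) (resTorsion (twin W K) K (lvl M) v.2))
    {ℓ : ℕ} (hℓ : IsKolyvaginPrime N W K 2 ℓ) (hgood : (haveI : Fact ℓ.Prime := ⟨hℓ.prime⟩;
      W.HasGoodReductionAtPrime ℓ)) (hℓM : FrobEqFrobInfty W K (2 ^ M) ℓ)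
    (v : galH1Torsion W (lvl M) × galH1Torsion (twin W K) (lvl M)) :
    v ∈ D.toSplitData.A ℓ ↔ f v ∈ pairA (N := N) W (sigmaQ K h2 hθ hd) M 1 ℓ := by
  rw [PairDataM.mem_toSplitData_A_iff, hDA₁, hDA₂, mem_a₁_iff hℓ.prime, mem_a₂_iff hℓ.prime,
    mem_pairA_iff W (sigmaQ K h2 hθ hd) M hℓ, hf₁, hf₂,
    mem_torsionLocalKer_iff_resTorsion_mem_place W hΔ h2 hθ hd hM hℓ hgood hℓM,
    mem_torsionLocalKer_twin_iff_hPsiKT_mem_place W hK hodd hΔ h2 hθ hd hM hℓ hgood hℓM]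

end Summit.BirchSwinnertonDyer.BirchSwinnertonDyer.Theorems.KolyvaginPairDataTwo

end
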